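import Mathlib
import Literature.Probability.Percolation.PercolationProofs
import Summits.CriticalPhenomena.PercolationContinuityZ3.Theorems.PercNearOneGluingAdditiveGluingGluePushforward
import Summits.CriticalPhenomena.PercolationContinuityZ3.Theorems.PercNearOneGluingAdditiveGluingGlueReach
import Summits.CriticalPhenomena.PercolationContinuityZ3.Theorems.PercNearOneGluingAdditiveGluingGoodStep24Main
import HarnessLib

/-! # Crux `PercNearOneGluing.AdditiveGluing` (stmt-CriticalPhenomena-4576), stub `stub_goodStep` — the block-growth calculus (spine of STUB-PLAN-stub_goodStep)

Support file for the inductive step `stub_goodStep` (stub-plan prover, plan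
`Cruxes/AdditiveGluing/STUB-PLAN-stub_goodStep.md`, §2 SPINE); lands `--supports stmt-CriticalPhenomena-4576`.

## Content (event bookkeeping only; no new definitions, no named facts)

Notation: `μ = prodBernoulli u`; for a block `S` of vertices, `X_S = ⋃_{s ∈ S} {a₀ ↔ s}`,
`Y_S = ⋃_{s ∈ S} {s ↔ b}`; `u/S` = the weighting with weight `1` on the non-loop pairs inside `S`
(the explicit lambda of `stub_gluePushforward`, "gluing the block").

* `blockGrowth_glue_real_openConn` (H3a, un-gluing the two-point function):
  `μ_{u/S}(a₀ ↔ b) = μ(a₀ ↔ b) + μ(a₀ ↮ b, X_S, Y_S)`.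
* `blockGrowth_glue_real_iUnion` (H3b): `μ_{u/S}(Y_S) = μ(Y_S)`.
* `blockGrowth_glue_real_pocket` (H3c): `μ_{u/S}{∀ z, z ∈ W' ↔ S ↔ z} = μ{∀ z, z ∈ W' ↔ S ↔ z}`.
  Together they turn the kernel hypothesis `hker` of `goodStep24_main` (stated in `u/S`) into an
  inequality about `u` alone ("block goodness in the un-glued graph").
* `blockGrowth_gap_insert` (H2, the exact peel identity): growing the block by one vertex `u₁`,
  `μ(a₀ ↮ b, X_{S∪u₁}, Y_{S∪u₁}) = μ(a₀ ↮ b, X_S, Y_S) + μ(X_S, Y_Sᶜ, u₁ ↔ b) + μ(Y_S, u₁ ↮ b, a₀ ↔ u₁, X_Sᶜ)`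
  and `μ(Y_{S∪u₁}) = μ(Y_S) + μ(Y_Sᶜ, u₁ ↔ b)`.
All statements hold for every weighting and every choice of vertices (no side conditions).
[folklore; Grimmett 1999 §1.3 (product measure bookkeeping); Kozma–Nitzan arXiv:2401.12397 §3.1 (gluing)]
-/

namespace Summit.CriticalPhenomena.PercolationContinuityZ3.Theorems

open MeasureTheory Set
open Literature.Probability.LatticeModels (prodBernoulli)
open Literature.Probability.Percolation (BondConfig openConn openConnIn openGraph openCluster)
open scoped BigOperators

noncomputable section
open Classical

section BlockGrowthGlue

open Literature.Probability.LatticeModels Literature.Probability.Percolation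

variable {n : ℕ}

/-- Preimage of a two-point event under gluing the block `S`:
`{ω | ω ∪ D_S ∈ {x ↔ y}} = {x ↔ y} ∪ (⋃_s {x ↔ s} ∩ ⋃_s {s ↔ y})`. [folklore] -/
theorem blockGrowth_glue_preimage_openConn (S : Finset (Fin n)) (x y : Fin n) :
    {ω : BondConfig (Fin n) | (ω ∪ {e | (∀ z ∈ e, z ∈ S) ∧ ¬ e.IsDiag}) ∈ openConn x y} =
      openConn x y ∪ ((⋃ s ∈ S, openConn x s) ∩ (⋃ s ∈ S, openConn s y)) := by
  ext ω
  rw [Set.mem_setOf_eq, stub_glueReach n S ω x y]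
  simp only [Set.mem_union, Set.mem_inter_iff, Set.mem_iUnion, exists_prop]

/-- Preimage of the block's reach of `y` under gluing the block: unchanged. [folklore] -/
theorem blockGrowth_glue_preimage_iUnion (S : Finset (Fin n)) (y : Fin n) :
    {ω : BondConfig (Fin n) | (ω ∪ {e | (∀ z ∈ e, z ∈ S) ∧ ¬ e.IsDiag}) ∈ ⋃ s ∈ S, openConn s y} =
      ⋃ s ∈ S, openConn s y := by
  ext ω
  simp only [Set.mem_setOf_eq, Set.mem_iUnion, exists_prop]
  constructor
  · rintro ⟨s, hs, h⟩
    rcases (stub_glueReach n S ω s y).1 h with h | ⟨-, s', hs', h'⟩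
    · exact ⟨s, hs, h⟩
    · exact ⟨s', hs', h'⟩
  · rintro ⟨s, hs, h⟩
    exact ⟨s, hs, (stub_glueReach n S ω s y).2 (Or.inl h)⟩

/-- **H3a — un-gluing the two-point function.**  For every weighting `u`, block `S` and vertices
`a₀, b`: `μ_{u/S}(a₀ ↔ b) = μ_u(a₀ ↔ b) + μ_u(a₀ ↮ b, a₀ ↔ S, S ↔ b)`.
[cite: KozmaNitzan2024, §3.1 (gluing, Remark p. 5)] -/
theorem blockGrowth_glue_real_openConn (u : Sym2 (Fin n) → unitInterval) (S : Finset (Fin n))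
    (a₀ b : Fin n) :
    (prodBernoulli (fun e : Sym2 (Fin n) =>
        if (∀ x ∈ e, x ∈ S) ∧ ¬ e.IsDiag then 1 else u e)).real (openConn a₀ b) =
      (prodBernoulli u).real (openConn a₀ b)
        + (prodBernoulli u).real
            ((openConn a₀ b)ᶜ ∩ (⋃ s ∈ S, openConn a₀ s) ∩ (⋃ s ∈ S, openConn s b)) := by
  rw [stub_gluePushforward n u S, blockGrowth_glue_preimage_openConn S a₀ b]
  have hsplit : (openConn a₀ b ∪ ((⋃ s ∈ S, openConn a₀ s) ∩ (⋃ s ∈ S, openConn s b)) :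
      Set (BondConfig (Fin n))) =
      openConn a₀ b ∪ ((openConn a₀ b)ᶜ ∩ (⋃ s ∈ S, openConn a₀ s) ∩ (⋃ s ∈ S, openConn s b)) := by
    ext ω
    simp only [Set.mem_union, Set.mem_inter_iff, Set.mem_compl_iff]
    tauto
  rw [hsplit]
  exact measureReal_union (Set.disjoint_left.2 fun ω hω hω' => hω'.1.1 hω) MeasurableSet.of_discrete
    (measure_ne_top _ _) (measure_ne_top _ _)

/-- **H3b — the block's reach of `b` is glue-invariant**: `μ_{u/S}(S ↔ b) = μ_u(S ↔ b)`.
[cite: KozmaNitzan2024, §3.1 (gluing, Remark p. 5)] -/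
theorem blockGrowth_glue_real_iUnion (u : Sym2 (Fin n) → unitInterval) (S : Finset (Fin n))
    (b : Fin n) :
    (prodBernoulli (fun e : Sym2 (Fin n) =>
        if (∀ x ∈ e, x ∈ S) ∧ ¬ e.IsDiag then 1 else u e)).real (⋃ s ∈ S, openConn s b) =
      (prodBernoulli u).real (⋃ s ∈ S, openConn s b) := by
  rw [stub_gluePushforward n u S, blockGrowth_glue_preimage_iUnion S b]

/-- **H3c — the law of the block's cluster is glue-invariant**:
`μ_{u/S}{∀ z, z ∈ W' ↔ S ↔ z} = μ_u{∀ z, z ∈ W' ↔ S ↔ z}`. [cite: KozmaNitzan2024, §3.1 (gluing, Remark p. 5)] -/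
theorem blockGrowth_glue_real_pocket (u : Sym2 (Fin n) → unitInterval) (S W' : Finset (Fin n)) :
    (prodBernoulli (fun e : Sym2 (Fin n) =>
        if (∀ x ∈ e, x ∈ S) ∧ ¬ e.IsDiag then 1 else u e)).real
        {ω : BondConfig (Fin n) | ∀ z : Fin n, (z ∈ W' ↔ ω ∈ ⋃ s ∈ S, openConn s z)} =
      (prodBernoulli u).real
        {ω : BondConfig (Fin n) | ∀ z : Fin n, (z ∈ W' ↔ ω ∈ ⋃ s ∈ S, openConn s z)} := by
  rw [stub_gluePushforward n u S]
  congr 1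
  ext ω
  simp only [Set.mem_setOf_eq]
  refine forall_congr' fun z => ?_
  have h := Set.ext_iff.1 (blockGrowth_glue_preimage_iUnion S z) ω
  rw [Set.mem_setOf_eq] at h
  rw [h]

end BlockGrowthGlue

section BlockGrowthPeel

open Literature.Probability.LatticeModels Literature.Probability.Percolation

variable {n : ℕ}

/-- Transitivity/symmetry bookkeeping for `openConn`. [folklore] -/
theorem blockGrowth_openConn_trans {ω : BondConfig (Fin n)} {x y z : Fin n}
    (hxy : ω ∈ openConn x y) (hyz : ω ∈ openConn y z) : ω ∈ openConn x z :=
  SimpleGraph.Reachable.trans hxy hyz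

/-- Symmetry of `openConn`. [folklore] -/
theorem blockGrowth_openConn_symm {ω : BondConfig (Fin n)} {x y : Fin n}
    (hxy : ω ∈ openConn x y) : ω ∈ openConn y x :=
  SimpleGraph.Reachable.symm hxy

/-- **H2 — the exact peel identity, two-point part.**  Growing the block `S` by a vertex `u₁`:
`μ(a₀ ↮ b, X_{S∪u₁}, Y_{S∪u₁}) = μ(a₀ ↮ b, X_S, Y_S) + μ(X_S, Y_Sᶜ, u₁ ↔ b) + μ(Y_S, u₁ ↮ b, a₀ ↔ u₁, X_Sᶜ)`
(`X_T = ⋃_{s∈T} {a₀ ↔ s}`, `Y_T = ⋃_{s∈T} {s ↔ b}`); the last term is the "hijack" mass.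
[folklore; Grimmett 1999 §1.3] -/
theorem blockGrowth_gap_insert (u : Sym2 (Fin n) → unitInterval) (S : Finset (Fin n))
    (b a₀ u₁ : Fin n) :
    (prodBernoulli u).real ((openConn a₀ b)ᶜ ∩ (⋃ s ∈ insert u₁ S, openConn a₀ s)
        ∩ (⋃ s ∈ insert u₁ S, openConn s b)) =
      (prodBernoulli u).real ((openConn a₀ b)ᶜ ∩ (⋃ s ∈ S, openConn a₀ s) ∩ (⋃ s ∈ S, openConn s b))
        + (prodBernoulli u).real ((⋃ s ∈ S, openConn a₀ s) ∩ (⋃ s ∈ S, openConn s b)ᶜ ∩ openConn u₁ b)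
        + (prodBernoulli u).real ((⋃ s ∈ S, openConn s b) ∩ (openConn u₁ b)ᶜ ∩ openConn a₀ u₁
            ∩ (⋃ s ∈ S, openConn a₀ s)ᶜ) := by
  set N : Set (BondConfig (Fin n)) := (openConn a₀ b)ᶜ with hN
  set XS : Set (BondConfig (Fin n)) := ⋃ s ∈ S, openConn a₀ s with hXS
  set YS : Set (BondConfig (Fin n)) := ⋃ s ∈ S, openConn s b with hYS
  have hX : (⋃ s ∈ insert u₁ S, openConn a₀ s : Set (BondConfig (Fin n))) = openConn a₀ u₁ ∪ XS := by
    rw [hXS]; exact Finset.set_biUnion_insert u₁ S _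
  have hY : (⋃ s ∈ insert u₁ S, openConn s b : Set (BondConfig (Fin n))) = openConn u₁ b ∪ YS := by
    rw [hYS]; exact Finset.set_biUnion_insert u₁ S _
  rw [hX, hY]
  -- the three-way partition
  have h1 : N ∩ (openConn a₀ u₁ ∪ XS) ∩ (openConn u₁ b ∪ YS) =
      (N ∩ XS ∩ YS ∪ XS ∩ YSᶜ ∩ openConn u₁ b) ∪ YS ∩ (openConn u₁ b)ᶜ ∩ openConn a₀ u₁ ∩ XSᶜ := by
    ext ω
    simp only [Set.mem_inter_iff, Set.mem_union, Set.mem_compl_iff, hN]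
    constructor
    · rintro ⟨⟨hab, hx | hx⟩, hy | hy⟩
      · exact absurd (blockGrowth_openConn_trans hx hy) hab
      · by_cases hxs : ω ∈ XS
        · exact Or.inl (Or.inl ⟨⟨hab, hxs⟩, hy⟩)
        · refine Or.inr ⟨⟨⟨hy, fun hub => hab (blockGrowth_openConn_trans hx hub)⟩, hx⟩, hxs⟩
      · by_cases hys : ω ∈ YS
        · exact Or.inl (Or.inl ⟨⟨hab, hx⟩, hys⟩)
        · exact Or.inl (Or.inr ⟨⟨hx, hys⟩, hy⟩)
      · exact Or.inl (Or.inl ⟨⟨hab, hx⟩, hy⟩)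
    · rintro ((⟨⟨hab, hx⟩, hy⟩ | ⟨⟨hx, hys⟩, hy⟩) | ⟨⟨⟨hy, hub⟩, hx⟩, hxs⟩)
      · exact ⟨⟨hab, Or.inr hx⟩, Or.inr hy⟩
      · refine ⟨⟨fun hab => hys ?_, Or.inr hx⟩, Or.inl hy⟩
        rw [hXS] at hx
        obtain ⟨s, hs, hxs⟩ := Set.mem_iUnion₂.1 hx
        rw [hYS]
        exact Set.mem_iUnion₂.2 ⟨s, hs,
          blockGrowth_openConn_trans (blockGrowth_openConn_symm hxs) hab⟩
      · refine ⟨⟨fun hab => hxs ?_, Or.inl hx⟩, Or.inr hy⟩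
        rw [hYS] at hy
        obtain ⟨s, hs, hsb⟩ := Set.mem_iUnion₂.1 hy
        rw [hXS]
        exact Set.mem_iUnion₂.2 ⟨s, hs,
          blockGrowth_openConn_trans hab (blockGrowth_openConn_symm hsb)⟩
  rw [h1]
  have hd1 : Disjoint (N ∩ XS ∩ YS) (XS ∩ YSᶜ ∩ openConn u₁ b) :=
    Set.disjoint_left.2 fun ω hω hω' => hω'.1.2 hω.2
  have hd2 : Disjoint (N ∩ XS ∩ YS ∪ XS ∩ YSᶜ ∩ openConn u₁ b)
      (YS ∩ (openConn u₁ b)ᶜ ∩ openConn a₀ u₁ ∩ XSᶜ) :=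
    Set.disjoint_left.2 fun ω hω hω' => by
      rcases hω with hω | hω
      · exact hω'.2 hω.1.2
      · exact hω.1.2 hω'.1.1.1
  rw [measureReal_union hd2 MeasurableSet.of_discrete (measure_ne_top _ _) (measure_ne_top _ _),
    measureReal_union hd1 MeasurableSet.of_discrete (measure_ne_top _ _) (measure_ne_top _ _)]

/-- **H2 — the exact peel identity, block part**: `μ(Y_{S∪u₁}) = μ(Y_S) + μ(Y_Sᶜ, u₁ ↔ b)`.
[folklore; Grimmett 1999 §1.3] -/
theorem blockGrowth_reach_insert (u : Sym2 (Fin n) → unitInterval) (S : Finset (Fin n))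
    (b u₁ : Fin n) :
    (prodBernoulli u).real (⋃ s ∈ insert u₁ S, openConn s b) =
      (prodBernoulli u).real (⋃ s ∈ S, openConn s b)
        + (prodBernoulli u).real ((⋃ s ∈ S, openConn s b)ᶜ ∩ openConn u₁ b) := by
  rw [Finset.set_biUnion_insert u₁ S]
  have h1 : (openConn u₁ b ∪ ⋃ s ∈ S, openConn s b : Set (BondConfig (Fin n))) =
      (⋃ s ∈ S, openConn s b) ∪ (⋃ s ∈ S, openConn s b)ᶜ ∩ openConn u₁ b := by
    ext ω
    simp only [Set.mem_union, Set.mem_inter_iff, Set.mem_compl_iff]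
    tauto
  rw [h1]
  exact measureReal_union (Set.disjoint_left.2 fun ω hω hω' => hω'.1 hω) MeasurableSet.of_discrete
    (measure_ne_top _ _) (measure_ne_top _ _)

end BlockGrowthPeel

section TwoLow

open Literature.Probability.LatticeModels Literature.Probability.Percolation

variable {n : ℕ}

/-- A two-element block: `⋃_{s ∈ {v, u₁}} {s ↔ x} = {v ↔ x} ∪ {u₁ ↔ x}`. [folklore] -/
theorem blockGrowth_biUnion_pair_left (v u₁ x : Fin n) :
    (⋃ s ∈ ({v, u₁} : Finset (Fin n)), openConn s x : Set (BondConfig (Fin n))) =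
      openConn v x ∪ openConn u₁ x := by
  rw [Finset.set_biUnion_insert, Finset.set_biUnion_singleton]

/-- A two-element block: `⋃_{s ∈ {v, u₁}} {x ↔ s} = {x ↔ v} ∪ {x ↔ u₁}`. [folklore] -/
theorem blockGrowth_biUnion_pair_right (v u₁ x : Fin n) :
    (⋃ s ∈ ({v, u₁} : Finset (Fin n)), openConn x s : Set (BondConfig (Fin n))) =
      openConn x v ∪ openConn x u₁ := by
  rw [Finset.set_biUnion_insert, Finset.set_biUnion_singleton]

end TwoLow

open Filter Literature.Probability.LatticeModels Literature.Probability.Percolation in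
/-- **The inductive step `stub_goodStep` for observers with at most TWO low neighbours, from the
two-vertex block kernel.**  If the displayed kernel holds — for every weighting `u`, relay set
`A ∋ b`, minimiser `a₀` of `μ_u(· ↔ b)` over `A`, and two distinct BAD vertices `v, u₁ ∉ A`
(`μ_u(v ↔ b), μ_u(u₁ ↔ b) < μ_u(a₀ ↔ b)`), block goodness of `{v, u₁}` in the un-glued graph,
`μ(a₀↔b) + μ(a₀↮b, a₀↔{v,u₁}, {v,u₁}↔b) ≤ μ({v,u₁}↔b) + Σ_{W'∩A=∅} μ(C(v)∪C(u₁) = W')·μ(sel W' ↔ b in W'ᶜ)`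
(= the hypothesis `hker` of `goodStep24_main` for `|S| = 2` after un-gluing, H3) — then the
registered stub `stub_goodStep` holds for every observer `o` with at most two low neighbours
(vertices `y ∉ A`, `y ≠ o`, `w s(o,y) ≠ 0`), for an arbitrary relay set.  Proof: `goodStep24_main`;
a bad block `S` of low neighbours with `|S| ≥ 2` is then exactly `{v, u₁}`, and H3
(`blockGrowth_glue_real_openConn/iUnion/pocket`) un-glues the kernel inequality.
[cite: KozmaNitzan2024, §3.2 (Thms 4–5 pp. 12–14, Question 7 p. 36)] -/
theorem goodStep_twoLow_of_blockGoodTwo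
    (hK : ∀ (n : ℕ) (u : Sym2 (Fin n) → unitInterval) (A : Finset (Fin n)) (b a₀ v u₁ : Fin n)
      (sel : Finset (Fin n) → Fin n),
      b ∈ A → a₀ ∈ A → v ∉ A → u₁ ∉ A → v ≠ u₁ → (∀ W, sel W ∈ A) →
      (∀ a ∈ A, (prodBernoulli u).real (openConn a₀ b) ≤ (prodBernoulli u).real (openConn a b)) →
      (prodBernoulli u).real (openConn v b) < (prodBernoulli u).real (openConn a₀ b) →
      (prodBernoulli u).real (openConn u₁ b) < (prodBernoulli u).real (openConn a₀ b) →
      (prodBernoulli u).real (openConn a₀ b)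
          + (prodBernoulli u).real ((openConn a₀ b)ᶜ ∩ (openConn a₀ v ∪ openConn a₀ u₁)
              ∩ (openConn v b ∪ openConn u₁ b))
        ≤ (prodBernoulli u).real (openConn v b ∪ openConn u₁ b)
          + ∑ W' ∈ (Finset.univ : Finset (Finset (Fin n))).filter (fun W' => Disjoint W' A),
              (prodBernoulli u).real
                  {ω : BondConfig (Fin n) | ∀ z : Fin n, (z ∈ W' ↔ ω ∈ openConn v z ∪ openConn u₁ z)}
                * (prodBernoulli u).real (openConnIn ((W' : Set (Fin n))ᶜ) (sel W') b)) :
    ∀ (n : ℕ) (w : Sym2 (Fin n) → unitInterval) (A : Finset (Fin n)) (o b : Fin n),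
      b ∈ A → o ∉ A →
      (∃ y : Fin n, y ∉ A ∧ y ≠ o ∧ (w s(o, y) : ℝ) ≠ 0) →
      (∀ y₁ y₂ y₃ : Fin n, y₁ ∉ A → y₂ ∉ A → y₃ ∉ A → y₁ ≠ o → y₂ ≠ o → y₃ ≠ o →
        (w s(o, y₁) : ℝ) ≠ 0 → (w s(o, y₂) : ℝ) ≠ 0 → (w s(o, y₃) : ℝ) ≠ 0 →
        y₁ = y₂ ∨ y₁ = y₃ ∨ y₂ = y₃) →
      (∀ w' : Sym2 (Fin n) → unitInterval,
        (Finset.univ.filter (fun v : Fin n => ∃ u : Fin n, 0 < (w' s(u, v) : ℝ))).card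
          < (Finset.univ.filter (fun v : Fin n => ∃ u : Fin n, 0 < (w s(u, v) : ℝ))).card →
        ∀ (A' : Finset (Fin n)) (o' b' : Fin n), b' ∈ A' → o' ∉ A' →
        ∀ (t : ℝ) (sel : Finset (Fin n) → Fin n), (∀ W, sel W ∈ A') →
          (∀ a ∈ A', 1 - t ≤ (prodBernoulli w').real (openConn a b')) →
          (prodBernoulli w').real ((⋃ a ∈ A', openConn o' a) ∩ (openConn o' b')ᶜ)
            + ∑ W ∈ (Finset.univ : Finset (Finset (Fin n))).filter (fun W => o' ∈ W ∧ Disjoint W A'),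
                (prodBernoulli w').real {ω : BondConfig (Fin n) | openCluster ω o' = (W : Set (Fin n))}
                  * (prodBernoulli w').real (openConnIn ((W : Set (Fin n))ᶜ) (sel W) b')ᶜ
            ≤ t) →
      ∀ (t : ℝ) (sel : Finset (Fin n) → Fin n), (∀ W, sel W ∈ A) →
        (∀ a ∈ A, 1 - t ≤ (prodBernoulli w).real (openConn a b)) →
        (prodBernoulli w).real ((⋃ a ∈ A, openConn o a) ∩ (openConn o b)ᶜ)
          + ∑ W ∈ (Finset.univ : Finset (Finset (Fin n))).filter (fun W => o ∈ W ∧ Disjoint W A),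
              (prodBernoulli w).real {ω : BondConfig (Fin n) | openCluster ω o = (W : Set (Fin n))}
                * (prodBernoulli w).real (openConnIn ((W : Set (Fin n))ᶜ) (sel W) b)ᶜ
          ≤ t := by
  intro n w A o b hb ho hlow htwo IH
  refine goodStep24_main n w A o b hb ho hlow IH ?_
  intro S sel a₀ h2 hoS hSA hSw hsel ha₀ hmin hbad
  -- the block has exactly two elements
  have hS2 : S.card = 2 := by
    by_contra hne
    have h3 : 2 < S.card := lt_of_le_of_ne h2 (Ne.symm hne)
    obtain ⟨y₁, hy₁, y₂, hy₂, y₃, hy₃, h12, h13, h23⟩ := Finset.two_lt_card.1 h3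
    have hlowS : ∀ y ∈ S, y ∉ A ∧ y ≠ o ∧ (w s(o, y) : ℝ) ≠ 0 := fun y hy =>
      ⟨Finset.disjoint_left.1 hSA hy, fun h => hoS (h ▸ hy), fun h => hSw y hy (Subtype.ext h)⟩
    rcases htwo y₁ y₂ y₃ (hlowS y₁ hy₁).1 (hlowS y₂ hy₂).1 (hlowS y₃ hy₃).1 (hlowS y₁ hy₁).2.1
      (hlowS y₂ hy₂).2.1 (hlowS y₃ hy₃).2.1 (hlowS y₁ hy₁).2.2 (hlowS y₂ hy₂).2.2 (hlowS y₃ hy₃).2.2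
      with h | h | h
    · exact h12 h
    · exact h13 h
    · exact h23 h
  obtain ⟨v, u₁, hvu, rfl⟩ := Finset.card_eq_two.1 hS2
  have hvA : v ∉ A := Finset.disjoint_left.1 hSA (Finset.mem_insert_self v {u₁})
  have hu₁A : u₁ ∉ A :=
    Finset.disjoint_left.1 hSA (Finset.mem_insert_of_mem (Finset.mem_singleton_self u₁))
  -- un-glue (H3) and read the block events of a two-element block
  rw [blockGrowth_glue_real_openConn, blockGrowth_glue_real_iUnion]
  simp only [blockGrowth_glue_real_pocket]
  simp only [blockGrowth_biUnion_pair_left, blockGrowth_biUnion_pair_right]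
  exact hK n _ A b a₀ v u₁ (fun W' => sel (insert o W')) hb ha₀ hvA hu₁A hvu (fun W' => hsel _)
    hmin (hbad v (Finset.mem_insert_self v {u₁}))
    (hbad u₁ (Finset.mem_insert_of_mem (Finset.mem_singleton_self u₁)))


open Filter Literature.Probability.LatticeModels Literature.Probability.Percolation in
/-- Registered helper stub `stub_goodStepTwoLow_sp` of crux stmt-CriticalPhenomena-4576 (stub-plan
prover of `stub_goodStep`): the two-vertex block kernel (`stub_blockGoodTwo`, displayed hypothesis)
implies the inductive step `stub_goodStep` for every observer with at most two low neighbours and an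
arbitrary relay set — `goodStep_twoLow_of_blockGoodTwo` under its registered one-line signature.
[cite: KozmaNitzan2024, §3.2 (Thms 4–5 pp. 12–14, Question 7 p. 36)] -/
theorem stub_goodStepTwoLow_sp : (∀ (n : ℕ) (u : Sym2 (Fin n) → unitInterval) (A : Finset (Fin n)) (b a₀ v u₁ : Fin n) (sel : Finset (Fin n) → Fin n), b ∈ A → a₀ ∈ A → v ∉ A → u₁ ∉ A → v ≠ u₁ → (∀ W, sel W ∈ A) → (∀ a ∈ A, (prodBernoulli u).real (openConn a₀ b) ≤ (prodBernoulli u).real (openConn a b)) → (prodBernoulli u).real (openConn v b) < (prodBernoulli u).real (openConn a₀ b) → (prodBernoulli u).real (openConn u₁ b) < (prodBernoulli u).real (openConn a₀ b) → (prodBernoulli u).real (openConn a₀ b) + (prodBernoulli u).real ((openConn a₀ b)ᶜ ∩ (openConn a₀ v ∪ openConn a₀ u₁) ∩ (openConn v b ∪ openConn u₁ b)) ≤ (prodBernoulli u).real (openConn v b ∪ openConn u₁ b) + ∑ W' ∈ (Finset.univ : Finset (Finset (Fin n))).filter (fun W' => Disjoint W' A), (prodBernoulli u).real {ω : BondConfig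 (Fin n) | ∀ z : Fin n, (z ∈ W' ↔ ω ∈ openConn v z ∪ openConn u₁ z)} * (prodBernoulli u).real (openConnIn ((W' : Set (Fin n))ᶜ) (sel W') b)) → ∀ (n : ℕ) (w : Sym2 (Fin n) → unitInterval) (A : Finset (Fin n)) (o b : Fin n), b ∈ A → o ∉ A → (∃ y : Fin n, y ∉ A ∧ y ≠ o ∧ (w s(o, y) : ℝ) ≠ 0) → (∀ y₁ y₂ y₃ : Fin n, y₁ ∉ A → y₂ ∉ A → y₃ ∉ A → y₁ ≠ o → y₂ ≠ o → y₃ ≠ o → (w s(o, y₁) : ℝ) ≠ 0 → (w s(o, y₂) : ℝ) ≠ 0 → (w s(o, y₃) : ℝ) ≠ 0 → y₁ = y₂ ∨ y₁ = y₃ ∨ y₂ = y₃) → (∀ w' : Sym2 (Fin n) → unitInterval, (Finset.univ.filter (fun v : Fin n => ∃ u : Fin n, 0 < (w' s(u, v) : ℝ))).card < (Finset.univ.filter (fun v : Fin n => ∃ u : Fin n, 0 < (w s(u, v) : ℝ))).card → ∀ (A' : Finset (Fin n)) (o' b' : Fin n), b' ∈ A' → o' ∉ A' → ∀ (t : ℝ)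 (sel : Finset (Fin n) → Fin n), (∀ W, sel W ∈ A') → (∀ a ∈ A', 1 - t ≤ (prodBernoulli w').real (openConn a b')) → (prodBernoulli w').real ((⋃ a ∈ A', openConn o' a) ∩ (openConn o' b')ᶜ) + ∑ W ∈ (Finset.univ : Finset (Finset (Fin n))).filter (fun W => o' ∈ W ∧ Disjoint W A'), (prodBernoulli w').real {ω : BondConfig (Fin n) | openCluster ω o' = (W : Set (Fin n))} * (prodBernoulli w').real (openConnIn ((W : Set (Fin n))ᶜ) (sel W) b')ᶜ ≤ t) → ∀ (t : ℝ) (sel : Finset (Fin n) → Fin n), (∀ W, sel W ∈ A) → (∀ a ∈ A, 1 - t ≤ (prodBernoulli w).real (openConn a b)) → (prodBernoulli w).real ((⋃ a ∈ A, openConn o a) ∩ (openConn o b)ᶜ) + ∑ W ∈ (Finset.univ : Finset (Finset (Fin n))).filter (fun W => o ∈ W ∧ Disjoint W A), (prodBernoulli w).real {ω : BondConfig (Fin n) | openCluster ω o = (W : Set (Fin n))} * (prodBernoulli w).real (openConnIn ((W : Set (Fin n))ᶜ) (sel W) b)ᶜ ≤ t :=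
  goodStep_twoLow_of_blockGoodTwo

end

end Summit.CriticalPhenomena.PercolationContinuityZ3.Theorems
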